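import Mathlib
import Literature.Analysis.Complex.CauchyPompeiu
import Literature.Geometry.Symplectic.JHolomorphicMap

/-!
# The frame-conjugated Cauchy–Riemann equation (stub `helper_conjugatedEquation`, line Sketch)

Crux `stmt-SmoothPoincare4-7826` (`TameOrBrodyR4`), line `Sketch`. Members of the pencil near a
flat-`J`-holomorphic map `u₀ : ℂ → ℝ⁴` are written `u = u₀ + Ψ w` where `Ψ ξ : ℂ² → ℝ⁴` is an
adapted complex frame along `u₀` (`Ψ ξ ∘ (i •) = J (u₀ ξ) ∘ Ψ ξ`, two-sided inverse `Ψinv ξ`).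
We prove the **conjugated Cauchy–Riemann equation**: `u` is flat-`J`-holomorphic iff `w`
satisfies
`2 ∂̄ w + Ψ⁻¹ ((∂ₓΨ) w + J(u₀) (∂_yΨ) w) + Ψ⁻¹ (J(u) - J(u₀)) (∂_y u) = 0`,
with `∂ₓ := D · 1`, `∂_y := D · i` and `∂̄ = Literature.Analysis.Complex.dbarAlong 1`.

The proof is pure calculus: flatness of a map `v` is equivalent to the single real equation
`∂ₓ v + J(v) ∂_y v = 0` at every point (`isJHolomorphicFlat_iff_partial`), the product rule
computes `D u`, and the frame relation `Ψ (i y) = J(u₀) (Ψ y)` identifies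
`Ψ (∂ₓ w) + J(u₀) Ψ (∂_y w)` with `Ψ (2 ∂̄ w)`.
-/

-- the registered namespace `Summit.SmoothPoincare4.SmoothPoincare4.…` repeats a component
set_option linter.dupNamespace false

noncomputable section

open scoped ContDiff Topology
open Literature.Analysis.Complex Literature.Geometry.Symplectic

namespace Summit.SmoothPoincare4.SmoothPoincare4.Cruxes.TameOrBrodyR4.Sketch

local notation "E4" => EuclideanSpace ℝ (Fin 4)

/-- **Flatness is one real equation per point.** For `J` with `J² = -1`, a map `v : ℂ → E` is
flat-`J`-holomorphic (`D v (i ζ) = J (v z) (D v ζ)` for all `z, ζ`) iff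
`∂ₓ v z + J (v z) (∂_y v z) = 0` for all `z`, where `∂ₓ v z = D v z 1`, `∂_y v z = D v z i`. -/
theorem isJHolomorphicFlat_iff_partial {E : Type*} [NormedAddCommGroup E] [NormedSpace ℝ E]
    (J : E → E →L[ℝ] E) (hJ2 : ∀ x v, J x (J x v) = -v) (v : ℂ → E) :
    IsJHolomorphicFlat J v ↔
      ∀ z, fderiv ℝ v z 1 + J (v z) (fderiv ℝ v z Complex.I) = 0 := by
  constructor
  · intro h z
    have h1 := h z 1
    rw [mul_one] at h1
    rw [h1, hJ2, add_neg_cancel]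
  · intro h z ζ
    have hI : fderiv ℝ v z Complex.I = J (v z) (fderiv ℝ v z 1) := by
      rw [eq_neg_of_add_eq_zero_left (h z), map_neg, hJ2, neg_neg]
    have hζ : ζ = (ζ.re : ℝ) • (1 : ℂ) + (ζ.im : ℝ) • Complex.I := by
      apply Complex.ext <;> simp
    have hIζ : Complex.I * ζ = (-ζ.im : ℝ) • (1 : ℂ) + (ζ.re : ℝ) • Complex.I := by
      apply Complex.ext <;> simp
    rw [hIζ]
    conv_rhs => rw [hζ]
    simp only [map_add, map_neg, ContinuousLinearMap.map_smul, hI, hJ2, neg_smul, smul_neg]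
    abel

/-- **Stub `helper_conjugatedEquation` (EQN).** The frame-conjugated Cauchy–Riemann equation:
for `J² = -1`, a flat-`J`-holomorphic smooth `u₀`, a smooth frame `Ψ` along `u₀` with two-sided
inverse `Ψinv` and `Ψ ξ (i y) = J (u₀ ξ) (Ψ ξ y)`, and a `C¹` map `w : ℂ → ℂ²`, the map
`u = u₀ + Ψ w` is flat-`J`-holomorphic iff
`2 ∂̄ w + Ψ⁻¹ ((∂ₓΨ) w + J(u₀) ((∂_yΨ) w)) + Ψ⁻¹ ((J(u) - J(u₀)) (∂_y u)) = 0` pointwise, where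
`∂_y u = ∂_y u₀ + (∂_yΨ) w + Ψ (∂_y w)`. -/
theorem helper_conjugatedEquation (J : E4 → E4 →L[ℝ] E4) (hJs : ContDiff ℝ ∞ J)
    (hJ2 : ∀ x v, J x (J x v) = -v)
    (u₀ : ℂ → E4) (hu₀s : ContDiff ℝ ∞ u₀) (hu₀J : IsJHolomorphicFlat J u₀)
    (Ψ : ℂ → (ℂ × ℂ) →L[ℝ] E4) (Ψinv : ℂ → E4 →L[ℝ] (ℂ × ℂ))
    (hΨs : ContDiff ℝ ∞ Ψ)
    (hleft : ∀ ξ, (Ψinv ξ).comp (Ψ ξ) = ContinuousLinearMap.id ℝ (ℂ × ℂ))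
    (hright : ∀ ξ, (Ψ ξ).comp (Ψinv ξ) = ContinuousLinearMap.id ℝ E4)
    (hΨJ : ∀ ξ (y : ℂ × ℂ), Ψ ξ (Complex.I • y) = J (u₀ ξ) (Ψ ξ y))
    (w : ℂ → ℂ × ℂ) (hw : ContDiff ℝ 1 w) :
    IsJHolomorphicFlat J (fun ξ => u₀ ξ + Ψ ξ (w ξ)) ↔
      ∀ ξ : ℂ, (2 : ℂ) • Literature.Analysis.Complex.dbarAlong (1 : ℂ) w ξ +
        Ψinv ξ ((fderiv ℝ Ψ ξ (1 : ℂ)) (w ξ) + J (u₀ ξ) ((fderiv ℝ Ψ ξ Complex.I) (w ξ))) +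
        Ψinv ξ ((J (u₀ ξ + Ψ ξ (w ξ)) - J (u₀ ξ))
          (fderiv ℝ u₀ ξ Complex.I + (fderiv ℝ Ψ ξ Complex.I) (w ξ) +
            Ψ ξ (fderiv ℝ w ξ Complex.I))) = 0 := by
  have _ := hJs
  -- the product rule for `u = u₀ + Ψ w`
  have hderiv : ∀ ξ v, fderiv ℝ (fun ξ => u₀ ξ + Ψ ξ (w ξ)) ξ v =
      fderiv ℝ u₀ ξ v + (fderiv ℝ Ψ ξ v) (w ξ) + Ψ ξ (fderiv ℝ w ξ v) := by
    intro ξ v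
    have hu₀d : DifferentiableAt ℝ u₀ ξ := (hu₀s.differentiable (by simp)).differentiableAt
    have hΨd : DifferentiableAt ℝ Ψ ξ := (hΨs.differentiable (by simp)).differentiableAt
    have hwd : DifferentiableAt ℝ w ξ := (hw.differentiable one_ne_zero).differentiableAt
    have h : HasFDerivAt (fun ξ => u₀ ξ + Ψ ξ (w ξ))
        (fderiv ℝ u₀ ξ + ((Ψ ξ).comp (fderiv ℝ w ξ) + (fderiv ℝ Ψ ξ).flip (w ξ))) ξ :=
      hu₀d.hasFDerivAt.add (hΨd.hasFDerivAt.clm_apply hwd.hasFDerivAt)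
    rw [h.fderiv]
    simp only [add_apply, ContinuousLinearMap.comp_apply, ContinuousLinearMap.flip_apply]
    abel
  rw [isJHolomorphicFlat_iff_partial J hJ2]
  refine forall_congr' fun ξ => ?_
  simp only [hderiv]
  -- flatness of `u₀` at `ξ`
  have hflat₀ : fderiv ℝ u₀ ξ 1 + J (u₀ ξ) (fderiv ℝ u₀ ξ Complex.I) = 0 :=
    (isJHolomorphicFlat_iff_partial J hJ2 u₀).1 hu₀J ξ
  -- `Ψ ξ` is a bijection with inverse `Ψinv ξ`
  have hΨΨinv : ∀ e, Ψ ξ (Ψinv ξ e) = e := fun e => by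
    simpa using congrArg (fun T : E4 →L[ℝ] E4 => T e) (hright ξ)
  have hinj : ∀ y, Ψ ξ y = 0 → y = 0 := fun y hy => by
    have h := congrArg (fun T : (ℂ × ℂ) →L[ℝ] (ℂ × ℂ) => T y) (hleft ξ)
    simp only [ContinuousLinearMap.comp_apply, ContinuousLinearMap.id_apply] at h
    rw [← h, hy, map_zero]
  -- the key identity: `Ψ ξ` applied to the conjugated expression is `∂ₓ u + J(u) ∂_y u`
  have key : Ψ ξ ((2 : ℂ) • dbarAlong (1 : ℂ) w ξ +
        Ψinv ξ ((fderiv ℝ Ψ ξ (1 : ℂ)) (w ξ) + J (u₀ ξ) ((fderiv ℝ Ψ ξ Complex.I) (w ξ))) +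
        Ψinv ξ ((J (u₀ ξ + Ψ ξ (w ξ)) - J (u₀ ξ))
          (fderiv ℝ u₀ ξ Complex.I + (fderiv ℝ Ψ ξ Complex.I) (w ξ) +
            Ψ ξ (fderiv ℝ w ξ Complex.I)))) =
      (fderiv ℝ u₀ ξ 1 + (fderiv ℝ Ψ ξ 1) (w ξ) + Ψ ξ (fderiv ℝ w ξ 1)) +
        J (u₀ ξ + Ψ ξ (w ξ)) (fderiv ℝ u₀ ξ Complex.I + (fderiv ℝ Ψ ξ Complex.I) (w ξ) +
          Ψ ξ (fderiv ℝ w ξ Complex.I)) := by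
    have h2dbar : (2 : ℂ) • dbarAlong (1 : ℂ) w ξ =
        fderiv ℝ w ξ 1 + Complex.I • fderiv ℝ w ξ Complex.I := by
      rw [dbarAlong_one, smul_smul, mul_inv_cancel₀ two_ne_zero, one_smul]
    rw [map_add (Ψ ξ), map_add (Ψ ξ), hΨΨinv, hΨΨinv, h2dbar, map_add (Ψ ξ), hΨJ, sub_apply,
      eq_neg_of_add_eq_zero_left hflat₀]
    simp only [map_add]
    abel
  constructor
  · intro h
    exact hinj _ (key.trans h)
  · intro h
    rw [← key, h, map_zero]

end Summit.SmoothPoincare4.SmoothPoincare4.Cruxes.TameOrBrodyR4.Sketch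

end
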